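import Summits.RiemannHypothesis.RiemannHypothesis.Theorems.TiltedLandingLaw421R3Lens1Coverage3

/-! # Lens-1 COVERAGE THEOREM (file A4 of 4: §10 rest, §11, §13b) — see file A1 for full header -/

namespace RhW08.Lens1Coverage

set_option linter.dupNamespace false

open Complex Set
open scoped ComplexConjugate
open Literature.Analysis.Complex
open Summit.RiemannHypothesis.RiemannHypothesis.Theorems.Splittings.JensenWindow
open RhIdea6.G17.W07C7 RhIdea6.G17.W07C7.Rev6 RhIdea6.G18.W07C8.Law421BirthS RhIdea6.G19.W07C11.Seam
open RhIdea6.G20.W07C12.Frac RhIdea6.G20.W07C12.StColP RhW07.C12.FieldSplit RhIdea6.G21.W07C13.TentMax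
open RhW07.C14.TwoSided RhW07.C14.Classes RhW07.C14.Lineage RhW07.C14.Booking
open RhW07.C13.Heredity RhIdea6.G22.W07C15pre.Injection RhW07.E3.Cell RhW07.E3.Lit
open RhW08.Round1 RhW08.StSwap RhW08.Round2 RhW08.QuadW RhW08.SealSwapQ RhW08.SealSwap RhW08.SuccB RhW08.SuccSplit
open RhW08.SuccTheft RhW08.Column RhW08.Hurwitz RhW08.ClusterQ RhW08.ClusterQM RhW08.NewtonDoor RhW08.NewtonDoorGenusOne RhW08.PurseP
open RhW08.AntiEscapeSplit7

/-- (S1) in the ROUTE'S FRAME: `EngineHyps5` (real entire, genus-one growth) + a level-`j` band state + `f^{(j+1)}(v) ≠ 0`. -/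
theorem coverIndexPairSum_of_frame {η : ℝ} {f : ℂ → ℂ} {x₀ s hmax R Hs : ℝ} {B j : ℕ} {v : ℂ}
    (hE : EngineHyps5 2 η f x₀ s hmax R Hs B) (hv : StTrkDQ η f x₀ s hmax R Hs B j v)
    (hz : iteratedDeriv (j + 1) f v ≠ 0) : CoverIndexPairSum f j v := by
  have hf : Summit.RiemannHypothesis.RiemannHypothesis.Theorems.Splittings.JensenWindow.RealEntireLt2 f :=
    realEntireLt2_of_hyps hE
  obtain ⟨ρ, C, hρ0, hρ, hgr⟩ := hf.growth
  obtain ⟨ρ', C', -, hρ', hgr'⟩ := Literature.Analysis.Complex.exists_growth_iteratedDeriv hf.diff hρ0 hρ hgr j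
  have hFd : Differentiable ℂ (iteratedDeriv j f) := differentiable_iteratedDeriv_of_entire hE.1 j
  have hv' : StColQ' η f x₀ s hmax R Hs B j v := hv
  obtain ⟨-, hFv, hy, -⟩ := hv'
  have hderiv : deriv (iteratedDeriv j f) v ≠ 0 := by
    rw [← iteratedDeriv_succ]; exact hz
  have hsimple : analyticOrderAt (iteratedDeriv j f) v = 1 :=
    (hFd.analyticAt v).analyticOrderAt_eq_one_of_zero_deriv_ne_zero hFv hderiv
  have hreal : ∀ z, iteratedDeriv j f (conj z) = conj (iteratedDeriv j f z) :=
    Literature.NumberTheory.LFunctions.iteratedDeriv_conj_of_conj (apply_conj_eq_conj hf.diff hf.real) j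
  exact coverIndexPairSum_of_growth hFd hgr' hρ' hreal hy hFv hsimple

/-- ★ PIECE R (cover criterion), UNCONDITIONAL in the frame: a band state with `f^{(j+1)}(v) ≠ 0` and POSITIVE COVER INDEX is
covered — some zero pair `{c, c̄}` of `f^{(j)}` has `v` strictly inside its Jensen disc. -/
theorem exists_cover_of_coverIndex_pos_frame {η : ℝ} {f : ℂ → ℂ} {x₀ s hmax R Hs : ℝ} {B j : ℕ} {v : ℂ}
    (hE : EngineHyps5 2 η f x₀ s hmax R Hs B) (hv : StTrkDQ η f x₀ s hmax R Hs B j v)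
    (hz : iteratedDeriv (j + 1) f v ≠ 0) (hι : 0 < coverIndex f j v) :
    ∃ c : ℂ, iteratedDeriv j f c = 0 ∧ c ≠ v ∧ c ≠ conj v ∧ (v.re - c.re) ^ 2 + v.im ^ 2 < c.im ^ 2 := by
  have hv' : StColQ' η f x₀ s hmax R Hs B j v := hv
  exact exists_cover_of_coverIndex_pos (coverIndexPairSum_of_frame hE hv hz) hv'.2.2.1 hι

/-- ★ WEAK FIELD ⇒ COVERED (B2 + R), unconditional in the frame: `‖K‖·Im v < ½` forces a covering zero pair. -/
theorem exists_cover_of_weak_frame {η : ℝ} {f : ℂ → ℂ} {x₀ s hmax R Hs : ℝ} {B j : ℕ} {v : ℂ}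
    (hE : EngineHyps5 2 η f x₀ s hmax R Hs B) (hv : StTrkDQ η f x₀ s hmax R Hs B j v)
    (hz : iteratedDeriv (j + 1) f v ≠ 0) (hκ : fieldStrength f j v < 1 / 2) :
    ∃ c : ℂ, iteratedDeriv j f c = 0 ∧ c ≠ v ∧ c ≠ conj v ∧ (v.re - c.re) ^ 2 + v.im ^ 2 < c.im ^ 2 := by
  have hv' : StColQ' η f x₀ s hmax R Hs B j v := hv
  exact exists_cover_of_coverIndex_pos_frame hE hv hz (coverIndex_pos_of_weak hv'.2.2.1 hκ)

/-- ★ ROOF LOCALISATION in the frame: the zeros of `f^{(j)}` off `{v, v̄}` are listed so that for every finset `S` of list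
indices containing the covering ones, each at distance `≥ d₁ > 0` from `v` together with its conjugate, `2ι·d₁ ≤ Im v · #S`. -/
theorem roof_localisation_frame {η : ℝ} {f : ℂ → ℂ} {x₀ s hmax R Hs : ℝ} {B j : ℕ} {v : ℂ}
    (hE : EngineHyps5 2 η f x₀ s hmax R Hs B) (hv : StTrkDQ η f x₀ s hmax R Hs B j v)
    (hz : iteratedDeriv (j + 1) f v ≠ 0) :
    ∃ (I : Type) (a : I → ℂ), (∀ i, iteratedDeriv j f (a i) = 0 ∧ a i ≠ v ∧ a i ≠ conj v) ∧
      ∀ (S : Finset I) (d₁ : ℝ), 0 < d₁ →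
        (∀ i, (v.re - (a i).re) ^ 2 + v.im ^ 2 < (a i).im ^ 2 → i ∈ S) →
        (∀ i ∈ S, d₁ ≤ ‖v - a i‖ ∧ d₁ ≤ ‖v - conj (a i)‖) →
        2 * coverIndex f j v * d₁ ≤ v.im * S.card := by
  have hv' : StColQ' η f x₀ s hmax R Hs B j v := hv
  obtain ⟨I, a, ha, hsum, hid⟩ := coverIndexPairSum_of_frame hE hv hz
  exact ⟨I, a, ha, fun S d₁ hd₁ hcov hd => coverIndex_mul_dist_le hv'.2.2.1 ha hsum hid S hcov hd₁ hd⟩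


/-! ## §11 NAMED NEWTON-SCALE NUMBERS and N♭ IN COORDINATES (B7)

The two zero-configuration clauses shared by N♯ and N♭ and N♭'s frame clause, NAMED (verbatim sub-terms of `NewtonNumbersSharpWith` /
`NewtonNumbersChildWith` at `K = newtonK f j v`), so that the cells of §12 are one-line configuration statements. -/

/-- The EXACT END NUMBER at Newton scale `r = (1+ρ₀)/‖K‖`: `(1+ρ₀)·(r·Σ_c ord_g(c)/((‖v−c‖ − r)‖v−c‖))`, `g := dslope (f^{(j)}) v`
(the END clause of N♯/N♭ is `endNumber f j v ρ₀ < ρ₀‖K‖`).  Its light-cone bound `≤ 2(1+ρ₀)²S₂/‖K‖` under `2r`-separation is (E1). -/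
noncomputable def endNumber (f : ℂ → ℂ) (j : ℕ) (v : ℂ) (ρ₀ : ℝ) : ℝ :=
  (1 + ρ₀) * ((1 + ρ₀) / ‖newtonK f j v‖ *
    ∑' c : ℂ, (analyticOrderNatAt (dslope (iteratedDeriv j f) v) c : ℝ) / ((‖v - c‖ - (1 + ρ₀) / ‖newtonK f j v‖) * ‖v - c‖))

/-- SEPARATION at Newton scale with margin `δ`: every zero of the cofactor is at distance `≥ (1+ρ₀)/‖K‖ + δ` from `v`. -/
def NewtonSep (f : ℂ → ℂ) (j : ℕ) (v : ℂ) (ρ₀ δ : ℝ) : Prop :=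
  ∀ c : ℂ, dslope (iteratedDeriv j f) v c = 0 → (1 + ρ₀) / ‖newtonK f j v‖ + δ ≤ ‖v - c‖

/-- BAND SLACK CHARGED AT THE CHILD's worst corner (N♭'s seventh clause at `K = newtonK f j v`). In coordinates the height part is (B6). -/
def ChildCornerSlack (f : ℂ → ℂ) (x₀ R Hs : ℝ) (j : ℕ) (v : ℂ) (ρ₀ : ℝ) : Prop :=
  (max (|(v - (newtonK f j v)⁻¹).re - x₀| + ρ₀ / ‖newtonK f j v‖ - R / 2) 0) ^ 2
      + ((j : ℝ) + 1) * (|(v - (newtonK f j v)⁻¹).im| + ρ₀ / ‖newtonK f j v‖) ^ 2 ≤ ((j : ℝ) + 1) * Hs ^ 2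

/-- (B4′) the child's height in ABSOLUTE VALUE: `|Im(v − K⁻¹)|·κ² = y·|Δ|`. -/
theorem abs_newtonChild_im {f : ℂ → ℂ} {j : ℕ} {v : ℂ} (hv : 0 < v.im) (hK0 : newtonK f j v ≠ 0) :
    |(v - (newtonK f j v)⁻¹).im| * fieldStrength f j v ^ 2
      = v.im * |fieldStrength f j v ^ 2 + coverIndex f j v - 1 / 2| := by
  have hh := newtonChild_im hv hK0
  have hκ2 : 0 ≤ fieldStrength f j v ^ 2 := sq_nonneg _
  have h1 : |(v - (newtonK f j v)⁻¹).im * fieldStrength f j v ^ 2|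
      = |v.im * (fieldStrength f j v ^ 2 + coverIndex f j v - 1 / 2)| := by rw [hh]
  rw [abs_mul, abs_mul, abs_of_nonneg hκ2, abs_of_pos hv] at h1
  exact h1

/-- (B7) N♭ IN COORDINATES (PROVED repackaging): `0 < κ`, the off-axis clause as `ρ₀κ ≤ |Δ|` ((B4′)), separation, the exact END number,
and the child corner slack give `NewtonNumbersChild`, hence a successor (`succ_of_newtonNumbersChild`). -/
theorem newtonNumbersChild_of_coordinates {f : ℂ → ℂ} {x₀ R Hs : ℝ} {j : ℕ} {v : ℂ} (hv : 0 < v.im)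
    {ρ₀ δ : ℝ} (hρ₀ : 0 < ρ₀) (hδ : 0 < δ) (hκ : 0 < fieldStrength f j v)
    (hoff : ρ₀ * fieldStrength f j v ≤ |fieldStrength f j v ^ 2 + coverIndex f j v - 1 / 2|)
    (hsep : NewtonSep f j v ρ₀ δ) (hend : endNumber f j v ρ₀ < ρ₀ * ‖newtonK f j v‖)
    (hS : ChildCornerSlack f x₀ R Hs j v ρ₀) :
    NewtonNumbersChild f x₀ R Hs j v := by
  have hnK : 0 < ‖newtonK f j v‖ := by
    unfold fieldStrength at hκ
    by_contra h
    push Not at h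
    have : ‖newtonK f j v‖ = 0 := le_antisymm h (norm_nonneg _)
    rw [this, zero_mul] at hκ
    exact lt_irrefl _ hκ
  have hK0 : newtonK f j v ≠ 0 := norm_pos_iff.mp hnK
  refine ⟨ρ₀, δ, hK0, hρ₀, ?_, hδ, hsep, hend, hS⟩
  have habs := abs_newtonChild_im hv hK0
  have hκ2 : 0 < fieldStrength f j v ^ 2 := by positivity
  have hρ : ρ₀ / ‖newtonK f j v‖ * fieldStrength f j v ^ 2 = ρ₀ * v.im * fieldStrength f j v := by
    unfold fieldStrength; field_simp
  refine le_of_mul_le_mul_right ?_ hκ2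
  rw [hρ, habs]
  have := mul_le_mul_of_nonneg_left hoff hv.le
  nlinarith [this]

/-- (B3′) N♯ IN COORDINATES with the named numbers (wrapper of (B3)). -/
theorem newtonNumbersSharp_of_coordinates' {f : ℂ → ℂ} {j : ℕ} {v : ℂ} (hv : 0 < v.im)
    {ρ₀ δ : ℝ} (hρ₀ : 0 < ρ₀) (hδ : 0 < δ)
    (hρκ : ρ₀ ≤ fieldStrength f j v)
    (hmargin : 2 * coverIndex f j v ≤ ρ₀ ^ 2 - 2 * ρ₀ * fieldStrength f j v)
    (hoff : ρ₀ * fieldStrength f j v ≤ fieldStrength f j v ^ 2 + coverIndex f j v - 1 / 2)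
    (hsep : NewtonSep f j v ρ₀ δ) (hend : endNumber f j v ρ₀ < ρ₀ * ‖newtonK f j v‖) :
    NewtonNumbersSharp f j v := by
  have hκ : 0 < fieldStrength f j v := lt_of_lt_of_le hρ₀ hρκ
  have hnK : 0 < ‖newtonK f j v‖ := by
    unfold fieldStrength at hκ
    by_contra h
    push Not at h
    have : ‖newtonK f j v‖ = 0 := le_antisymm h (norm_nonneg _)
    rw [this, zero_mul] at hκ
    exact lt_irrefl _ hκ
  exact newtonNumbersSharp_of_coordinates hv (norm_pos_iff.mp hnK) hρ₀ hδ hρκ hmargin hoff hsep hend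

/-! ## §13b (v2) THE JENSEN DIP LEMMA — owner of cell «L» (deep part), PROVED

Real-axis dual of the tree's PROVED `Literature.Analysis.Complex.jensen_circle` (Jensen 1913 / Pólya): at a NON-CROSSING DIP of `|g|` on the
axis (`g x ≠ 0`, `g′ x = 0`, `Re (g″x/gx) > 0`) the point `x` lies in the open Jensen disc of some zero of `g` — because off every open disc each
pole term of `(g′/g)′(x) = −Σ m(a)(x−a)⁻² + ψ_R′(x)` has real part `≤ 0` and `ψ_R′ → 0` (Titchmarsh Lemma α at centre `x`,
`Literature.Analysis.Complex.titchmarsh_logDeriv_sub_sum`, error `tendsto_growth_div_sq`).  Consequence in the frame: ANY non-crossing dip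
of `f^{(j+1)}` at a real `xs` with `|xs − x₀| + Hs ≤ R/2` yields a successor (`succ_of_dip_deep`; strip heredity `analyticHeredity_landed`
bounds the cone zero's height by `Hs`, the cone bounds its abscissa by `xs ± Hs`).  No Rouché circle, no margin, no door. -/

section JensenDipSec

open Filter Metric Topology

/-! ### §13b.1 Algebra of one pole term -/

/-- `Re (w²)⁻¹ < 0 ⟹ |Re w| < |Im w|` (the 45° cone). -/
theorem abs_re_lt_abs_im_of_re_inv_sq_neg {w : ℂ} (h : ((w ^ 2)⁻¹).re < 0) : |w.re| < |w.im| := by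
  rw [Complex.inv_re] at h
  have hns : 0 ≤ Complex.normSq (w ^ 2) := Complex.normSq_nonneg _
  have hre : (w ^ 2).re = w.re ^ 2 - w.im ^ 2 := by
    rw [sq, Complex.mul_re]; ring
  have hneg : (w ^ 2).re < 0 := by
    by_contra hcon
    push Not at hcon
    have : 0 ≤ (w ^ 2).re / Complex.normSq (w ^ 2) := div_nonneg hcon hns
    linarith
  rw [hre] at hneg
  exact sq_lt_sq.1 (by linarith)

/-- The pole term `m/(z − a)` has derivative `−m/(x − a)²` at `x ≠ a`. -/
theorem hasDerivAt_poleTerm (m : ℂ) {x a : ℂ} (hxa : x ≠ a) :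
    HasDerivAt (fun z : ℂ => m / (z - a)) (-(m / (x - a) ^ 2)) x := by
  have hsub : HasDerivAt (fun z : ℂ => z - a) 1 x := (hasDerivAt_id x).sub_const a
  have hne : x - a ≠ 0 := sub_ne_zero.2 hxa
  have hinv := hsub.inv hne
  have h := hinv.const_mul m
  have e : (fun z : ℂ => m / (z - a)) = fun z => m * (z - a)⁻¹ := by
    funext z; rw [div_eq_mul_inv]
  rw [e]
  refine h.congr_deriv ?_
  field_simp

/-! ### §13b.2 The Jensen dip lemma -/

/-- **JENSEN DIP LEMMA.**  `g` entire with `‖g z‖ ≤ C e^{‖z‖^ρ}` (`0 ≤ ρ < 2`); at a real point `x` with `g x ≠ 0`, `g′ x = 0` and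
`0 < Re (g″ x / g x)` there is a zero `a` of `g` whose open Jensen disc contains `x`: `|x − Re a| < |Im a|`.
[Jensen 1913 / Pólya: the real-axis sign of `(g′/g)′` off the Jensen discs; proof via Titchmarsh1986 §3.9 Lemma α] -/
theorem jensenDip {g : ℂ → ℂ} (hg : Differentiable ℂ g) {ρ C : ℝ} (hρ0 : 0 ≤ ρ) (hρ : ρ < 2)
    (hgr : ∀ z, ‖g z‖ ≤ C * Real.exp (‖z‖ ^ ρ)) {x : ℝ} (hx : g x ≠ 0) (hx1 : deriv g x = 0)
    (hx2 : 0 < (deriv (deriv g) x / g x).re) :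
    ∃ a : ℂ, g a = 0 ∧ |x - a.re| < |a.im| := by
  classical
  have hCpos : 0 < C := growthConst_pos hgr hx
  have hgx : 0 < ‖g (x : ℂ)‖ := norm_pos_iff.2 hx
  set δ : ℝ := (deriv (deriv g) x / g x).re with hδ
  set K : ℝ := Real.log C - Real.log ‖g (x : ℂ)‖ + 1 with hK
  -- choose `R` with the Titchmarsh error below `δ`
  have hlim : Tendsto (fun R : ℝ ↦ 64 * ((K + (|x| + 2 * R) ^ ρ) / R ^ 2)) atTop (𝓝 0) := by
    simpa using (tendsto_growth_div_sq K x hρ0 hρ).const_mul 64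
  obtain ⟨R, hRδ, hRge⟩ := ((hlim.eventually_lt_const hx2).and (eventually_ge_atTop (1 : ℝ))).exists
  have hRpos : 0 < R := by linarith
  set M : ℝ := C * Real.exp ((|x| + 2 * R) ^ ρ) with hM
  obtain ⟨S, m, ψ, hS, hS', hψd, hψeq, -, hψ'⟩ :=
    titchmarsh_logDeriv_sub_sum hg hx hRpos (norm_le_on_closedBall hρ0 hgr x R)
  have hlog : Real.log (M / ‖g (x : ℂ)‖) + 1 = K + (|x| + 2 * R) ^ ρ := by
    rw [hK, hM, Real.log_div (by positivity) hgx.ne', Real.log_mul hCpos.ne' (Real.exp_pos _).ne',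
      Real.log_exp]
    ring
  -- `x ∉ S` (no zero at `x`)
  have hxS : ∀ a ∈ S, (x : ℂ) ≠ a := by
    intro a ha hxa; exact hx (by rw [hxa]; exact (hS a ha).1)
  -- the identity `g′/g = Σ m/(z − a) + ψ` holds on a neighbourhood of `x`
  have hball : ball (x : ℂ) R ∈ 𝓝 (x : ℂ) := isOpen_ball.mem_nhds (mem_ball_self hRpos)
  have hne_nhds : ∀ᶠ z in 𝓝 (x : ℂ), g z ≠ 0 :=
    (hg.continuous.continuousAt (x := (x : ℂ))).eventually_ne hx
  have hEq : (fun z => deriv g z / g z) =ᶠ[𝓝 (x : ℂ)] fun z => (∑ a ∈ S, (m a : ℂ) / (z - a)) + ψ z := by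
    filter_upwards [hball, hne_nhds] with z hz hz0
    rw [hψeq z hz hz0]; ring
  -- derivative of the left side at `x`
  have hdg : Differentiable ℂ (deriv g) := by
    have := differentiable_iteratedDeriv_of_entire hg 1
    simpa [iteratedDeriv_one] using this
  have hL : HasDerivAt (fun z => deriv g z / g z) (deriv (deriv g) x / g x) x := by
    have h : HasDerivAt (fun z => deriv g z / g z)
        ((deriv (deriv g) x * g x - deriv g x * deriv g x) / g x ^ 2) x :=
      (hdg.differentiableAt.hasDerivAt (x := (x : ℂ))).div (hg.differentiableAt.hasDerivAt) hx
    refine h.congr_deriv ?_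
    rw [hx1]; field_simp; ring
  -- derivative of the right side at `x`
  have hR : HasDerivAt (fun z => (∑ a ∈ S, (m a : ℂ) / (z - a)) + ψ z)
      ((∑ a ∈ S, -((m a : ℂ) / (x - a) ^ 2)) + deriv ψ x) x := by
    have hsum : HasDerivAt (fun z => ∑ a ∈ S, (m a : ℂ) / (z - a)) (∑ a ∈ S, -((m a : ℂ) / (x - a) ^ 2)) x := by
      have h := HasDerivAt.sum (fun a ha => hasDerivAt_poleTerm (m a : ℂ) (hxS a ha))
      rwa [Finset.sum_fn] at h
    have hψx : HasDerivAt ψ (deriv ψ x) x :=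
      (hψd.differentiableAt hball).hasDerivAt
    exact hsum.add hψx
  -- the two derivatives agree
  have hderiv_eq : deriv (deriv g) x / g x = (∑ a ∈ S, -((m a : ℂ) / (x - a) ^ 2)) + deriv ψ x := by
    have h1 := hL.deriv
    have h2 : deriv (fun z => deriv g z / g z) x = (∑ a ∈ S, -((m a : ℂ) / (x - a) ^ 2)) + deriv ψ x := by
      rw [hEq.deriv_eq]; exact hR.deriv
    rw [← h1, h2]
  -- real parts: if every pole term had `Re (x − a)⁻² ≥ 0` we would get `δ ≤ ‖ψ′ x‖ < δ`
  by_contra hcone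
  push Not at hcone
  have hterm : ∀ a ∈ S, 0 ≤ ((m a : ℂ) / ((x : ℂ) - a) ^ 2).re := by
    intro a ha
    have hma : ((m a : ℂ) / ((x : ℂ) - a) ^ 2) = (m a : ℝ) * (((x : ℂ) - a) ^ 2)⁻¹ := by
      rw [div_eq_mul_inv]; norm_cast
    rw [hma, Complex.re_ofReal_mul]
    apply mul_nonneg (Nat.cast_nonneg _)
    by_contra hneg
    push Not at hneg
    have hc := abs_re_lt_abs_im_of_re_inv_sq_neg hneg
    have : |x - a.re| < |a.im| := by simpa using hc
    exact absurd this (not_lt.2 (hcone a (hS a ha).1))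
  have hre : δ = (∑ a ∈ S, -((m a : ℂ) / (x - a) ^ 2)).re + (deriv ψ x).re := by
    rw [hδ, hderiv_eq, Complex.add_re]
  rw [Complex.re_sum] at hre
  have hsum_nonpos : ∑ a ∈ S, (-((m a : ℂ) / ((x : ℂ) - a) ^ 2)).re ≤ 0 := by
    apply Finset.sum_nonpos
    intro a ha
    rw [Complex.neg_re]
    linarith [hterm a ha]
  have hψre : (deriv ψ x).re ≤ 64 * ((K + (|x| + 2 * R) ^ ρ) / R ^ 2) := by
    have hxin : (x : ℂ) ∈ closedBall (x : ℂ) (R / 8) := mem_closedBall_self (by linarith)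
    calc (deriv ψ x).re ≤ ‖deriv ψ x‖ := Complex.re_le_norm _
      _ ≤ 64 * (Real.log (M / ‖g (x : ℂ)‖) + 1) / R ^ 2 := hψ' _ hxin
      _ = 64 * ((K + (|x| + 2 * R) ^ ρ) / R ^ 2) := by rw [hlog]; ring
  have : δ < δ := by
    calc δ = _ := hre
      _ ≤ 0 + 64 * ((K + (|x| + 2 * R) ^ ρ) / R ^ 2) := add_le_add hsum_nonpos hψre
      _ < δ := by rw [zero_add]; exact hRδ
  exact lt_irrefl _ this

/-- The Jensen dip lemma for a REAL entire `g`: the cone zero may be taken in the UPPER half-plane. -/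
theorem jensenDip_pos {g : ℂ → ℂ} (hg : Differentiable ℂ g) {ρ C : ℝ} (hρ0 : 0 ≤ ρ) (hρ : ρ < 2)
    (hgr : ∀ z, ‖g z‖ ≤ C * Real.exp (‖z‖ ^ ρ)) (hreal : ∀ t : ℝ, (g t).im = 0) {x : ℝ} (hx : g x ≠ 0)
    (hx1 : deriv g x = 0) (hx2 : 0 < (deriv (deriv g) x / g x).re) :
    ∃ a : ℂ, g a = 0 ∧ 0 < a.im ∧ |x - a.re| < a.im := by
  obtain ⟨a, ha, hcone⟩ := jensenDip hg hρ0 hρ hgr hx hx1 hx2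
  have him : a.im ≠ 0 := by
    intro h0; rw [h0, abs_zero] at hcone; exact absurd hcone (not_lt.2 (abs_nonneg (x - a.re)))
  rcases lt_or_gt_of_ne him with hneg | hpos
  · refine ⟨conj a, ?_, by simpa using hneg, ?_⟩
    · rw [apply_conj_eq_conj hg hreal a, ha, map_zero]
    · simpa [abs_of_neg hneg] using hcone
  · exact ⟨a, ha, hpos, by simpa [abs_of_pos hpos] using hcone⟩

/-! ### §13b.3 The deep-dip successor -/

/-- **DEEP-DIP SUCCESSOR.**  In the frame, a non-crossing dip of `f^{(j+1)}` at a real point `xs` with `|xs − x₀| + Hs ≤ R/2` gives a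
successor state at level `j+1`.  (Dip data exactly as in the lens-1 cell datum `LandingDip`, minus its localisation `|xs − Re v| < 2·Im v`.) -/
theorem succ_of_dip_deep {η : ℝ} {f : ℂ → ℂ} {x₀ s hmax R Hs : ℝ} {B j : ℕ}
    (hE : EngineHyps5 2 η f x₀ s hmax R Hs B) {xs m A : ℝ}
    (hm : (m : ℂ) = iteratedDeriv (j + 1) f xs) (h2 : iteratedDeriv (j + 2) f xs = 0)
    (hA : ((2 * A : ℝ) : ℂ) = iteratedDeriv (j + 3) f xs) (hmA : 0 < m * A)
    (hdeep : |xs - x₀| + Hs ≤ R / 2) :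
    ∃ u : ℂ, StTrkDQ η f x₀ s hmax R Hs B (j + 1) u := by
  obtain ⟨hdiff, hreal, hgrowth, hs, hsh, hhR, h3R, hHs, hstrip, hHsR, hpair, hcol, hhalf, hη0, hη1, hrem⟩ := hE
  set g : ℂ → ℂ := iteratedDeriv (j + 1) f with hg_def
  have hgd : Differentiable ℂ g := differentiable_iteratedDeriv_of_entire hdiff (j + 1)
  have hgreal : ∀ t : ℝ, (g t).im = 0 := im_iteratedDeriv_ofReal hdiff hreal (j + 1)
  -- growth of `g` in the tree form
  have hC0 : InClass f Hs := ⟨hdiff, hreal, hgrowth, hstrip⟩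
  have hm0 : m ≠ 0 := by
    intro h0; rw [h0, zero_mul] at hmA; exact lt_irrefl _ hmA
  have hgx : g xs ≠ 0 := by
    rw [← hm]; exact_mod_cast hm0
  have hgne : g ≠ 0 := by
    intro h0; exact hgx (by rw [h0]; rfl)
  have hCj : InClass g Hs := analyticHeredity_landed f Hs (j + 1) hHs hC0 hgne
  obtain ⟨ρ', C', hρ'0, hρ', -, hgr'⟩ := StubAnalyticHeredity.growth_treeForm hgd hCj.2.2.1
  -- dip data for `g`
  have hx1 : deriv g xs = 0 := by
    rw [hg_def, ← iteratedDeriv_succ]; exact h2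
  have hx2 : 0 < (deriv (deriv g) xs / g xs).re := by
    have e : deriv (deriv g) = iteratedDeriv (j + 3) f := by
      rw [hg_def, ← iteratedDeriv_succ, ← iteratedDeriv_succ]
    rw [e, ← hA, ← hm]
    have : (((2 * A : ℝ) : ℂ) / (m : ℂ)).re = 2 * A / m := by
      rw [← Complex.ofReal_div, Complex.ofReal_re]
    rw [this]
    rcases lt_or_gt_of_ne hm0 with hneg | hpos
    · have hA' : A < 0 := by nlinarith
      exact div_pos_of_neg_of_neg (by linarith) hneg
    · have hA' : 0 < A := by nlinarith
      exact div_pos (by linarith) hpos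
  obtain ⟨a, ha, ha0, hcone⟩ := jensenDip_pos hgd hρ'0 hρ' hgr' hgreal hgx hx1 hx2
  -- strip and band
  have haHs : a.im ≤ Hs := by
    have := hCj.2.2.2 a ha
    rwa [abs_of_pos ha0] at this
  have hare : |a.re - x₀| ≤ R / 2 := by
    have h1 : |a.re - x₀| ≤ |xs - a.re| + |xs - x₀| := by
      have := abs_sub_le (a.re) xs x₀
      rw [abs_sub_comm a.re xs] at this
      linarith
    linarith [hcone.le]
  have hmax : max (|a.re - x₀| - R / 2) 0 = 0 := max_eq_right (by linarith)
  have hsq : a.im ^ 2 ≤ Hs ^ 2 := by nlinarith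
  have hmul := mul_le_mul_of_nonneg_left hsq (show (0 : ℝ) ≤ ((j + 1 : ℕ) : ℝ) by positivity)
  have hband : (max (|a.re - x₀| - R / 2) 0) ^ 2 + ((j + 1 : ℕ) : ℝ) * a.im ^ 2 ≤ ((j + 1 : ℕ) : ℝ) * Hs ^ 2 := by
    rw [hmax]; simpa using hmul
  exact ⟨a, hgne, ha, ha0, by simpa using hband, haHs⟩


end JensenDipSec


end RhW08.Lens1Coverage
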